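import Summits.Ventures.CertifiedArithmetic.LowPrec.GemmThetaLawGenE3M2
import Summits.Ventures.CertifiedArithmetic.LowPrec.GemmThetaLawGenBinary32

/-!
# The E3M2×E3M2 law is a θ-certificate at every precision `p ≥ 18`; the binary32 envelope

HONEST FRAMING (venture CertifiedArithmetic / cell `pub-lowprec`, seat gemm, gen 13): certified
error envelopes and provably optimal rounding/accumulation schemes for low-precision formats under
stated cost models; every table by two implementations; no hardware or vendor claims.

`thetaCert_e3m2Law`: the kernel tables `lawCheck_e3m2` (42,200 classes), `contOK_e3m2`,
`succOK_e3m2`, `lam_bound_e3m2` read through the landed law-generic soundness theorem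
`LawData.lawCheck_cert` (`GemmThetaLawGenCert.lean`) give `ThetaCertificate φ Π S ψ θ ρ β_pair κ`
for EVERY accumulator format `φ` with `manBits ≥ 17` (`p ≥ 18`), `qexp φ ≤ -8`, `2^(manBits+20) ≤
maxRat φ`, for the product alphabet E3M2×E3M2 (grid `2^-8`) under sequential round-to-nearest-even
accumulation; `abs_dot_err_le_e3m2_Binary32` is the binary32 instance (`p = 24`) as a two-sided
all-`n` envelope via `ThetaCertificate.abs_err_le`, with every E3M2×E3M2 product a letter
(`mul_mem_PiL_e3m2`, kernel over all pairs of magnitudes through `PiL_of_magTest`). This is the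
SUP side of gemm.tex Thm t:thetap6 (E3M2 row) for every `p ≥ 18`; the attainment side and `p < 18`
remain the two-implementation finite case analysis (not kernel-checked).
-/

namespace Literature.ComputerArithmetic.FloatingPoint

namespace MiniFloat

open Finset

namespace ThetaLaw

/-- KERNEL FACT: continuity of the `ψ` tables of the E3M2×E3M2 law. [cell] -/
theorem contOK_e3m2 : e3m2Law.contOK = true := by decide

/-- KERNEL FACT: every successor-vertex class list of the E3M2×E3M2 law serves `T = 0`
(`LawData.succOK`, the supplement of `GemmThetaLawGenSucc.lean`). [cell] -/
theorem succOK_e3m2 : e3m2Law.succOK = true := by decide +kernel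

/-- KERNEL FACT: the letters of the E3M2×E3M2 law are at most `200704` grid units. [cell] -/
theorem lam_bound_e3m2 : ∀ z ∈ e3m2Law.lam, z.natAbs ≤ 200704 := by decide +kernel

/-- THE E3M2×E3M2 LAW IS A θ-CERTIFICATE AT EVERY PRECISION `p ≥ 18` (grid `2^-8`; exponent range
`qexp ≤ -8`, `2^(m+20) ≤ maxRat`): `θ = (6149M + 12288)/65536 = 6149·2^(p-17) + 3/16`, `ρ = 29 /
6`, `β_pair = 31 / 2`, `κ = 2^16/(6149·2^m + 12288)`. [cell; kernel tables + the landed soundness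
theorem `lawCheck_cert`] -/
theorem thetaCert_e3m2Law (φ : Format) (hm : 17 ≤ φ.manBits) (hq : φ.qexp ≤ -8)
    (hR : (2 : ℚ) ^ (φ.manBits + 20) ≤ φ.maxRat) :
    ThetaCertificate φ (e3m2Law.PiL 8) (e3m2Law.SL 8 φ) (e3m2Law.psiL 8 φ)
      (e3m2Law.thetaL φ.manBits) e3m2Law.rhoL e3m2Law.betaL
      (e3m2Law.kappaL φ.manBits) := by
  obtain ⟨h1, h2, h3, h4⟩ := pow_params (a := 16) (by omega : 16 + 1 ≤ φ.manBits)
  exact e3m2Law.lawCheck_cert lawCheck_e3m2 contOK_e3m2 succOK_e3m2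
    (K := 2 ^ (φ.manBits - 16)) h1 (by rw [show e3m2Law.M0 = 2 ^ 16 from rfl]; exact h2) h3 h4
    (fun h => absurd h (by decide)) (G := 8) (by exact_mod_cast hq) hR
    (lam_small (c := 18) (by norm_num) lam_bound_e3m2 (by omega))
    (show (0 : ℤ) < 6149 * 2 ^ φ.manBits + 12288 by positivity) (by decide) (by decide)
    (show (0 : ℤ) < 6149 * 2 ^ φ.manBits + 12288 by positivity)

/-- The quanta of E3M2 and E3M2 multiply to `2^-8`. [cite: RouhaniEtAl2023MX, Table 1] -/
theorem quantum_e3m2 : Format.E3M2.quantum * Format.E3M2.quantum = 1 / 2 ^ 8 := by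
  rw [Format.E3M2_maxRat.2]; norm_num

/-- EVERY `E3M2·E3M2` PRODUCT IS A LETTER of the E3M2×E3M2 law (grid `2^-8`). [cell, kernel: all
64·64 pairs of magnitudes in quanta against `0 :: X` through `PiL_of_magTest`] -/
theorem mul_mem_PiL_e3m2 (a : MiniFloat Format.E3M2) (b : MiniFloat Format.E3M2) :
    e3m2Law.PiL 8 (a.toRat * b.toRat) :=
  PiL_of_magTest _ _ quantum_e3m2 (by decide +kernel) a b

/-- binary32 satisfies the format hypotheses of `thetaCert_e3m2Law` (`manBits = 23`,
`qexp = -149 ≤ -8`, `2^43 ≤ maxRat`). [cite: IEEE7542019, Table 3.5] -/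
theorem Binary32_hyps_e3m2 : Format.Binary32.manBits = 23 ∧ Format.Binary32.qexp ≤ -8 ∧
    (2 : ℚ) ^ (Format.Binary32.manBits + 20) ≤ Format.Binary32.maxRat := by
  refine ⟨rfl, by decide, ?_⟩
  rw [Format.Binary32_maxRat.1, show Format.Binary32.manBits = 23 from rfl]
  norm_num

/-- THE LAW'S CONSTANTS AT `p = 24` (binary32): `θ`, `κ`, `ρ`, `β_pair`. [cell] -/
theorem lawConstants_e3m2_Binary32 :
    e3m2Law.thetaL 23 = 12593155 / 16 ∧ e3m2Law.kappaL 23 = 16 / 12593155 ∧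
    e3m2Law.rhoL = 29 / 6 ∧ e3m2Law.betaL = 31 / 2 := by
  have hB : e3m2Law.Bj 16 = 6149 := by decide
  have hS : e3m2Law.Sj 16 = 12288 := by decide
  simp only [LawData.thetaL, LawData.kappaL, LawData.rhoL, LawData.betaL,
    show e3m2Law.kb = 16 from rfl, hB, hS, show e3m2Law.th1 = 6149 from rfl,
    show e3m2Law.th0 = 12288 from rfl, show e3m2Law.thD = 65536 from rfl,
    show e3m2Law.rhoN = 29 from rfl, show e3m2Law.rhoD = 6 from rfl,
    show e3m2Law.betaN = 31 from rfl, show e3m2Law.betaD = 2 from rfl]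
  norm_num

/-- E3M2×E3M2 PRODUCTS INTO binary32, SEQUENTIAL RNE, EVERY `n = m + 1`: the two-sided all-`n`
envelope `|ŝ - Σ a_j b_j| ≤ (1 - θ/(m + θ(1 + max ρ β_pair + κ)))·Σ|a_j b_j|` with the law's
constants at `p = 24` (`lawConstants_e3m2_Binary32`). [cell, gemm.tex Thm t:thetap6 (E3M2 row) +
Prop. Θ(i)] -/
theorem abs_dot_err_le_e3m2_Binary32 (a : ℕ → MiniFloat Format.E3M2)
    (b : ℕ → MiniFloat Format.E3M2) (m : ℕ) :
    |(seqSum Format.Binary32 (fun j => (a j).toRat * (b j).toRat) m).toRat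
        - ∑ j ∈ range (m + 1), (a j).toRat * (b j).toRat|
      ≤ (1 - e3m2Law.thetaL 23 / (m + e3m2Law.thetaL 23 *
          (1 + (max e3m2Law.rhoL e3m2Law.betaL + e3m2Law.kappaL 23))))
          * ∑ j ∈ range (m + 1), |(a j).toRat * (b j).toRat| := by
  obtain ⟨h1, h2, h3⟩ := Binary32_hyps_e3m2
  have hc := thetaCert_e3m2Law Format.Binary32 (by rw [h1]; norm_num) h2 h3
  rw [h1] at hc
  exact hc.abs_err_le (fun q hq => PiL_neg _ _ hq) _ (fun j => mul_mem_PiL_e3m2 (a j) (b j)) m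

end ThetaLaw

end MiniFloat

end Literature.ComputerArithmetic.FloatingPoint
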